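import Summits.HodgeConjecture.HodgeConjecture.Theorems.F0P3cStCharTSEllipticCriterionConverse   -- ★ p849769 (E2) `n = 3` model (F0P2-p02 (g15)); brings ★ kit `F0P3cStCharTSAdjugateEigen`, ★ `torusU`, `IsRegularElt`
import Summits.HodgeConjecture.HodgeConjecture.Theorems.F0P3cStCharTSWeylHypCM                   -- ★ p849636 `isUnit_of_ne_zero_of_nonsplit` (LH2-p01 (g3)): the field-like local carrier at a non-split `v`
import Literature.NumberTheory.Rogawski1990.EndoscopicClassTransfer                             -- ★ `isStablyConj_iff_eq_of_fin_one` (the `U(Φ₁)` slot)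
import Summits.HodgeConjecture.HodgeConjecture.Theorems.F0P3cStCharTSStableInvariantsH         -- ★ p851650 (B2)+SEAM (F0P3a-p05 (g22)): `exists_isRoot_charpoly_fst_of_mem_hyperbolicSet`, `isRegularElt_fst_of_isLocalGRegular`, `isLocalGRegular_of_mem_hyperbolicSet`
import Mathlib.LinearAlgebra.Matrix.Charpoly.Coeff
import HarnessLib

/-!
# F0 · P3c · line LH6 «StCharTS» — «HYP-CONJ₂★» (B3) of the ST-STABLE-H★ road: a regular `γ ∈ U(σ, Φ₂)(K)` with an eigenvalue `α`, `α σ(α) ≠ 1`, is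
# `U`-conjugate to `diag(α, σ(α)⁻¹)`; hence on the HYPERBOLIC classes of `H_v = U(Φ₂)(L⁺_v) × U(Φ₁)(L⁺_v)` stable conjugacy IS conjugacy [Rogawski1990 §3.1 p. 19; §3.6; §12.5 p. 182]

Cell `pub/hodgecm-mathlib`, crux H413 = `stmt-HodgeConjecture-24833` (`--supports` lane, helper), route HCCMUnconditional; seat LH1-p03 (g8), brick (B3)
«HYP-CONJ₂★» of F0P3-p04 (g18)'s road «ST-STABLE-H★» (NAMING 2026-09-02T13:58:38Z, LEAD F0P3a-plan (g14) T13-40 «=» + pin (p1) «no Hilbert 90»), whose head (B4)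
discharges the outer antecedent `hstab` of the RUNG-0 block of the LH6 leaf `Cruxes/H413/Lines/F0_P3c_StCharTSPaydown.lean`; companion ★-cand (B2)+SEAM
`Theorems/F0P3cStCharTSStableInvariantsH` (F0P3a-p05 (g22)) supplies the Ω-reading `exists_isRoot_charpoly_fst_of_mem_hyperbolicSet` that feeds §4 here.
THEOREMS ONLY, sorry-free; no definition ∕ instance ∕ notation ∕ named fact.  The `n = 2` PORT of ★ (E2) `F0P3cStCharTSEllipticCriterionConverse` (same road, no middle vector).

THE MATHEMATICS.
* §1 MATRIX CORE (`K` a field, `σ` involutive, `J = Φ₂ = antidiag(1, 1)`): `M` with `(σM)ᵀ J M = J`, `det M ≠ 0`, SEPARABLE characteristic polynomial and a root `α` with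
  `α σ(α) ≠ 1` admits a unitary frame `B` (`(σB)ᵀ J B = J`, `det B ≠ 0`) with `B⁻¹ M B = diag(α, σ(α)⁻¹)` (`exists_unitary_frame_diagonal_of_isRoot₂`).  Road = (E2)'s:
  `Q := adj(α·1 − M)` has `tr Q = charpoly′(α) ≠ 0` (Jacobi, `2 × 2`), so some `Qᵢᵢ ≠ 0`; the column `v := Q eᵢ` is a right `α`-eigenvector, the row `r := eᵢᵀ Q` a left one,
  and they PAIR, `r · v = Qᵢᵢ · tr Q ≠ 0` (rank one of the adjugate of a singular `2 × 2` matrix); the partner `v′ := σ ∘ (J r)` is a right eigenvector for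
  `α* := σ(α)⁻¹` with `h(v′, y) = r · y`; `v`, `v′` are ISOTROPIC (`α σ(α) ≠ 1`), `a := h(v, v′) = σ(r · v) ≠ 0`, and `B := [v | a⁻¹ v′]` has Gram matrix `Φ₂`.
* §2 GROUP FORM in `U = ↥(unitaryGroupOfForm σ Φ₂)`: `∃ g ∈ U, g γ g⁻¹ = diag(d) ∈ torusU`, `d₀ = α`, `d₁ = σ(α)⁻¹` (`exists_conj_mem_torusU_of_isRoot₂`); over a FIELD-LIKE
  commutative ring (`x ≠ 0 → IsUnit x`, the tree's local carrier at a non-split place) the same with `σ(α) · d₁ = 1` (`exists_conj_mem_torusU_of_isRoot_of_isUnit₂`).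
* §3 «STABLE ⇒ RATIONAL ON THE HYPERBOLIC CLASSES OF `U(Φ₂)`»: two REGULAR elements of `U` with an eigenvalue `α`, `α σ(α) ≠ 1`, that are conjugate in the ambient `GL₂`
  are conjugate IN `U` — both are `U`-conjugate to the SAME `diag(α, σ(α)⁻¹)` (the second slot is forced by the torus relation) (`isConj_of_isConj_coe_of_isRoot₂`).
* §4 `H_v`-LEVEL at a NON-SPLIT place `v` of `L⁺` (`E_v = L_w` a field propositionally, ★ `isUnit_of_ne_zero_of_nonsplit`): for `γ_H = (h₀, u) ∼_st γ_H′` in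
  `H_v = U(Φ₂)(L⁺_v) × U(Φ₁)(L⁺_v)` (★ `IsLocalStablyConjH`) with `h₀` regular and `charpoly h₀` having a root `α`, `α σ(α) ≠ 1`: **`γ_H` and `γ_H′` are CONJUGATE in `H_v`**
  (`isConj_of_isLocalStablyConjH_of_isRoot`; the `U(Φ₁)`-slots are equal, ★ `isStablyConj_iff_eq_of_fin_one`).  With ★-cand `F0P3cStCharTSStableInvariantsH`
  (`exists_isRoot_charpoly_fst_of_mem_hyperbolicSet`: `G`-regular with `ι_v(γ_H) ∈ Ω` ⇒ such an `α` exists) this is (B4)'s «on `{G-regular} ∖ V_H` stable conjugacy is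
  `H_v`-conjugacy».
* §5 THE (B4) HEAD BY NAME: `isConj_of_isLocalStablyConjH_of_mem_hyperbolicSet (hns) (hab) (hreg) (hΩ) : IsConj a b` — `G`-regular `γ_H` with `ι_v(γ_H) ∈ Ω`
  (★ `F0P3cStCharTSTorusDefs.hyperbolicSet`) stably conjugate to `γ_H′` is conjugate to it (§4 + ★ p851650's Ω-reading); primed form without `hreg` (implied by `hΩ`), and the
  IFF `isLocalStablyConjH_iff_isConj_of_mem_hyperbolicSet` (converse ★ `isStablyConjH_of_isConj`).
HONEST LABEL: HC_CM is proved only modulo the 7 printed citations (2 remaining: hLiu418 = `stmt-HodgeConjecture-24832`, h413 = `stmt-HodgeConjecture-24833`) until rung 0 closes;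
this file is count-neutral matrix algebra and closes no organ.

References: [Rogawski1990] J. D. Rogawski, *Automorphic Representations of Unitary Groups in Three Variables*, Ann. of Math. Stud. 123 (1990): §3.1 p. 19 (stable conjugacy;
`H¹(F, T) = 1` for the split torus of `U(2)` — here replaced by the explicit normal form), §3.6, §1.9–§1.10 pp. 8–9 (`Φ`, `M = {d(α, ᾱ⁻¹)}`), §12.5 p. 182, §4.3 p. 42;
[HornJohnson2013] R. A. Horn, C. R. Johnson, *Matrix Analysis*, 2nd ed. (2013), §0.8.2, (0.8.10.1) (adjugate, Jacobi's formula). -/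

set_option autoImplicit false
-- the mandated namespace has the single-problem summit's repeated segment (`HodgeConjecture.HodgeConjecture`)
set_option linter.dupNamespace false

open Matrix Polynomial
open Literature.NumberTheory.Automorphic Literature.NumberTheory.Automorphic.UnitaryGroup Literature.NumberTheory.Rogawski1990
open Summit.HodgeConjecture.HodgeConjecture.Cruxes.H413.F0P3cStCharTSAdjugateEigen
open scoped MatrixGroups

namespace Summit.HodgeConjecture.HodgeConjecture.Cruxes.H413.F0P3cStCharTSHypConjTwo

/-! ## §0 The `2 × 2` adjugate engine (Jacobi's trace formula; rank one of the adjugate of a singular matrix) and the entries of `Φ₂` -/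

section Adjugate

variable {R : Type*} [CommRing R]

/-- **Jacobi's formula for `2 × 2` matrices**: `tr adj(t·1 − M) = charpoly′(M)(t)` (`= 2t − tr M`; explicit expansion of both sides). [cite: HornJohnson2013, (0.8.10.1)] -/
theorem trace_adjugate_scalar_sub_eq_eval_derivative_charpoly_two (M : Matrix (Fin 2) (Fin 2) R) (t : R) :
    trace (adjugate (scalar (Fin 2) t - M)) = (derivative M.charpoly).eval t := by
  rw [Matrix.charpoly, det_fin_two]
  simp only [charmatrix_apply_eq, charmatrix_apply_ne _ _ _ (by decide : (0 : Fin 2) ≠ 1),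
    charmatrix_apply_ne _ _ _ (by decide : (1 : Fin 2) ≠ 0)]
  simp only [derivative_mul, derivative_sub, derivative_neg, derivative_X, derivative_C, sub_zero,
    eval_add, eval_sub, eval_mul, eval_neg, eval_X, eval_C, eval_one, eval_zero]
  rw [trace_fin_two, adjugate_fin_two]
  simp [Matrix.sub_apply, Matrix.scalar_apply]

/-- **Rank one of the adjugate of a SINGULAR `2 × 2` matrix, on the diagonal**: `det A = 0 ⇒ (adj A · adj A)ᵢᵢ = (adj A)ᵢᵢ · tr (adj A)` (Cayley–Hamilton for `adj A`,
whose determinant is `det A = 0`). [cite: HornJohnson2013, §0.8.2] -/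
theorem adjugate_mul_adjugate_apply_self_of_det_eq_zero_two (A : Matrix (Fin 2) (Fin 2) R) (h : A.det = 0) (i : Fin 2) :
    (adjugate A * adjugate A) i i = adjugate A i i * trace (adjugate A) := by
  rw [det_fin_two] at h
  rw [trace_fin_two, mul_apply, Fin.sum_univ_two, adjugate_fin_two]
  fin_cases i <;> simp <;> linear_combination -h

/-- Entries of `Φ_N = (StdForm.antidiagonal N).over R`: `[j = rev i]`. [cite: Rogawski1990, §1.9 p. 8] -/
theorem antidiagonal_over_apply' {N : ℕ} (i j : Fin N) : (StdForm.antidiagonal N).over R i j = if j = i.rev then (1 : R) else 0 := by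
  simp only [StdForm.over, Matrix.map_apply, StdForm.antidiagonal_J_apply]
  split_ifs <;> simp

end Adjugate

/-! ## §1 The matrix core over a field: an explicit unitary frame diagonalising `γ` (`n = 2`) -/

section Core

variable {K : Type*} [Field K] (σ : K →+* K)

/-- The explicit antidiagonal form `Φ₂ = antidiag(1, 1)`: symmetric, an involution, `σ`-fixed, `det = −1`. [cite: Rogawski1990, §1.9 p. 8] -/
private theorem phi2_facts {J : Matrix (Fin 2) (Fin 2) K} (hJ : ∀ i j, J i j = if j = i.rev then 1 else 0) :
    J = !![0, 1; 1, 0] ∧ Jᵀ = J ∧ J * J = 1 ∧ J.map σ = J ∧ J.det = -1 := by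
  have hJ' : J = !![0, 1; 1, 0] := by
    ext i j; rw [hJ]; fin_cases i <;> fin_cases j <;> rfl
  subst hJ'
  refine ⟨rfl, ?_, ?_, ?_, ?_⟩
  · ext i j; fin_cases i <;> fin_cases j <;> rfl
  · ext i j; fin_cases i <;> fin_cases j <;> simp [Matrix.mul_apply, Fin.sum_univ_two]
  · ext i j; fin_cases i <;> fin_cases j <;> simp
  · simp [det_fin_two]

/-- **«HYP-CONJ₂★», MATRIX FORM.**  `K` a field, `σ` an involutive ring endomorphism, `J = Φ₂` (given by its entries), `M` with `(σM)ᵀ J M = J`, `det M ≠ 0`, SEPARABLE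
characteristic polynomial, and a root `α` with `α σ(α) ≠ 1`.  Then there is an invertible `B` with `(σB)ᵀ J B = J` (a unitary frame) and `B⁻¹ M B = diag(d)`, `d 0 = α`,
`d 1 = σ(α)⁻¹`, both `d k ≠ 0`.  Proof = the road of the module docstring (adjugate eigenvectors `v = Q eᵢ`, `r = eᵢᵀ Q`, partner `v′ = σ ∘ (J r)`, isotropy, normalisation
`[v | a⁻¹ v′]`). [cite: Rogawski1990, §12.5 p. 182; §3.6] [cite: HornJohnson2013, §0.8.2] -/
theorem exists_unitary_frame_diagonal_of_isRoot₂ {J M : Matrix (Fin 2) (Fin 2) K} (hσ : ∀ a, σ (σ a) = a) (hJ : ∀ i j, J i j = if j = i.rev then 1 else 0)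
    (hM : (M.map σ)ᵀ * J * M = J) (hdet : M.det ≠ 0) (hsep : M.charpoly.Separable) {α : K} (hα : M.charpoly.IsRoot α)
    (hne : α * σ α ≠ 1) :
    ∃ B : Matrix (Fin 2) (Fin 2) K, B.det ≠ 0 ∧ (B.map σ)ᵀ * J * B = J ∧
      ∃ d : Fin 2 → K, (∀ k, d k ≠ 0) ∧ d 0 = α ∧ d 1 = (σ α)⁻¹ ∧ B⁻¹ * M * B = diagonal d := by
  obtain ⟨hJe, hJt, hJJ, hJσ, hJdet⟩ := phi2_facts σ hJ
  have hsl : ∀ (c : K) (x y : Fin 2 → K), hermForm σ J (c • x) y = σ c * hermForm σ J x y := fun c x y => by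
    simpa using hermForm_smul_smul_eq σ J c 1 x y
  have hsr : ∀ (c : K) (x y : Fin 2 → K), hermForm σ J x (c • y) = c * hermForm σ J x y := fun c x y => by
    simpa using hermForm_smul_smul_eq σ J 1 c x y
  -- the singular matrix `α·1 − M` and its adjugate
  set A₀ : Matrix (Fin 2) (Fin 2) K := scalar (Fin 2) α - M with hA₀def
  have hA₀ : A₀.det = 0 := by rw [hA₀def, ← eval_charpoly]; exact hα
  set Q : Matrix (Fin 2) (Fin 2) K := adjugate A₀ with hQdef
  -- Jacobi: `tr Q = p′(α) ≠ 0`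
  have htr : trace Q ≠ 0 := by
    rw [hQdef, hA₀def, trace_adjugate_scalar_sub_eq_eval_derivative_charpoly_two]
    exact hsep.eval₂_derivative_ne_zero (RingHom.id K) hα
  obtain ⟨i, -, hii⟩ : ∃ i ∈ Finset.univ, Q i i ≠ 0 := Finset.exists_ne_zero_of_sum_ne_zero htr
  -- the right eigenvector `v` (column `i`) and the left eigenvector `r` (row `i`) of `Q`, both for `α`
  set v : Fin 2 → K := fun k => Q k i with hvdef
  set r : Fin 2 → K := fun k => Q i k with hrdef
  have hv : M *ᵥ v = α • v := mulVec_adjugate_col_eq_smul M α hA₀ i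
  have hr : r ᵥ* M = α • r := vecMul_adjugate_row_eq_smul M α hA₀ i
  have hpair : r ⬝ᵥ v = Q i i * trace Q := by
    rw [← adjugate_mul_adjugate_apply_self_of_det_eq_zero_two A₀ hA₀ i, mul_apply]; rfl
  have hpair_ne : r ⬝ᵥ v ≠ 0 := by rw [hpair]; exact mul_ne_zero hii htr
  have hv_ne : v ≠ 0 := fun h => hii (by simpa [hvdef] using congrFun h i)
  have hα0 : α ≠ 0 := by
    rintro rfl
    rw [zero_smul] at hv
    exact hv_ne ((Matrix.mulVec_injective_iff_isUnit.2 ((Matrix.isUnit_iff_isUnit_det M).2 (isUnit_iff_ne_zero.2 hdet)))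
      (by rw [hv, mulVec_zero]))
  have hσα0 : σ α ≠ 0 := (map_ne_zero σ).2 hα0
  -- the partner eigenvector `v' := σ ∘ (J r)` for `α* = (σ α)⁻¹`, with `h(v', y) = r · y`
  set v' : Fin 2 → K := ⇑σ ∘ (J *ᵥ r) with hv'def
  have hσv' : (⇑σ ∘ v') = J *ᵥ r := funext fun k => hσ _
  have hF1 : ∀ y, hermForm σ J v' y = r ⬝ᵥ y := fun y => by
    rw [hermForm_apply, hσv', ← vecMul_transpose, ← dotProduct_mulVec, mulVec_mulVec, hJt, hJJ, one_mulVec]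
  have hF2 : M *ᵥ v' = (σ α)⁻¹ • v' := by
    have hMt : Mᵀ * J * M.map σ = J := by
      have e := congrArg transpose hM
      rwa [transpose_mul, transpose_mul, transpose_transpose, hJt, ← mul_assoc] at e
    have hr' : Mᵀ *ᵥ r = α • r := by rw [mulVec_transpose]; exact hr
    set z : Fin 2 → K := M.map σ *ᵥ (J *ᵥ r) with hzdef
    have h1 : Mᵀ *ᵥ (J *ᵥ z) = Mᵀ *ᵥ (α⁻¹ • r) := by
      rw [hzdef, mulVec_mulVec, mulVec_mulVec, hMt, mulVec_smul, hr', smul_smul, inv_mul_cancel₀ hα0, one_smul,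
        mulVec_mulVec, hJJ, one_mulVec]
    have hinjT : Function.Injective (Mᵀ).mulVec :=
      Matrix.mulVec_injective_iff_isUnit.2 ((Matrix.isUnit_iff_isUnit_det _).2 (by rw [det_transpose]; exact isUnit_iff_ne_zero.2 hdet))
    have h2 : J *ᵥ z = α⁻¹ • r := hinjT h1
    have h3 : z = α⁻¹ • (J *ᵥ r) := by
      have e := congrArg (J.mulVec) h2
      rwa [mulVec_mulVec, hJJ, one_mulVec, mulVec_smul] at e
    have h4 : (⇑σ ∘ (M *ᵥ v')) = z := by
      rw [hzdef, ← hσv']; exact funext fun k => RingHom.map_mulVec σ M v' k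
    funext k
    have e := congrFun h4 k
    simp only [Function.comp_apply, h3, Pi.smul_apply, smul_eq_mul] at e
    have e2 := congrArg σ e
    rw [hσ, map_mul, map_inv₀] at e2
    rw [e2, Pi.smul_apply, smul_eq_mul, hv'def, Function.comp_apply]
  set αs : K := (σ α)⁻¹ with hαsdef
  have hαs0 : αs ≠ 0 := inv_ne_zero hσα0
  have hσαs : σ αs * αs = (σ α * α)⁻¹ := by rw [hαsdef, map_inv₀, hσ, mul_inv, mul_comm]
  have hne' : σ α * α ≠ 1 := by rwa [mul_comm]
  -- isotropy of `v` and `v'`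
  have hiso_v : hermForm σ J v v = 0 := by
    have e := sub_one_mul_hermForm_eq_zero_of_eigen σ hM hv hv
    exact (mul_eq_zero.1 e).resolve_left (sub_ne_zero.2 hne')
  have hiso_v' : hermForm σ J v' v' = 0 := by
    have e := sub_one_mul_hermForm_eq_zero_of_eigen σ hM hF2 hF2
    refine (mul_eq_zero.1 e).resolve_left (sub_ne_zero.2 ?_)
    rw [hσαs]; exact fun h => hne' (inv_eq_one.1 h)
  -- the pairing `ā := h(v', v) = r · v ≠ 0`, `a := h(v, v') = σ ā ≠ 0`
  set ab : K := hermForm σ J v' v with habdef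
  have hab : ab = r ⬝ᵥ v := hF1 v
  have hab0 : ab ≠ 0 := by rw [hab]; exact hpair_ne
  set a : K := hermForm σ J v v' with hadef
  have ha : a = σ ab := by rw [hadef, habdef]; exact hermForm_comm σ hσ hJt hJσ v' v
  have ha0 : a ≠ 0 := by rw [ha]; exact (map_ne_zero σ).2 hab0
  have hσa : σ a = ab := by rw [ha, hσ]
  have hσainv : σ a⁻¹ = ab⁻¹ := by rw [map_inv₀, hσa]
  -- the normalised frame `B = [v | a⁻¹ v']`
  set B : Matrix (Fin 2) (Fin 2) K := (Matrix.of ![v, a⁻¹ • v'])ᵀ with hBdef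
  have hB0 : ∀ k, B k 0 = v k := fun k => by simp [hBdef]
  have hB1 : ∀ k, B k 1 = a⁻¹ * v' k := fun k => by simp [hBdef]
  have hBc0 : (fun k => B k 0) = v := funext hB0
  have hBc1 : (fun k => B k 1) = a⁻¹ • v' := funext fun k => by rw [hB1, Pi.smul_apply, smul_eq_mul]
  have hJij : ∀ i' j', J i' j' = (!![0, 1; 1, 0] : Matrix (Fin 2) (Fin 2) K) i' j' := fun i' j' => by rw [hJe]
  have G00 : hermForm σ J v v = 0 := hiso_v
  have G01 : hermForm σ J v (a⁻¹ • v') = 1 := by rw [hsr, ← hadef, inv_mul_cancel₀ ha0]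
  have G10 : hermForm σ J (a⁻¹ • v') v = 1 := by rw [hsl, ← habdef, hσainv, inv_mul_cancel₀ hab0]
  have G11 : hermForm σ J (a⁻¹ • v') (a⁻¹ • v') = 0 := by rw [hermForm_smul_smul_eq, hiso_v', mul_zero]
  have hGramB : (B.map σ)ᵀ * J * B = J := by
    ext i' j'
    rw [transpose_map_mul_mul_apply, hJij]
    fin_cases i' <;> fin_cases j' <;> simp [hBc0, hBc1, G00, G01, G10, G11]
  -- `det B ≠ 0` from the Gram identity (`det J = −1 ≠ 0`)
  have hdetB : B.det ≠ 0 := by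
    intro hB
    have e := congrArg Matrix.det hGramB
    rw [det_mul, det_mul, hB, mul_zero, hJdet] at e
    exact (neg_ne_zero.2 (one_ne_zero (α := K))) e.symm
  -- the diagonal form
  set d : Fin 2 → K := ![α, αs] with hddef
  have hd : ∀ k, d k ≠ 0 := by
    intro k; fin_cases k
    · exact hα0
    · exact hαs0
  have hMB : M * B = B * diagonal d := by
    ext k j
    have e0 := congrFun hv k
    have e2 := congrFun hF2 k
    simp only [mulVec, dotProduct, Fin.sum_univ_two, Pi.smul_apply, smul_eq_mul] at e0 e2
    rw [mul_diagonal, mul_apply, Fin.sum_univ_two]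
    fin_cases j
    · simp [hB0, hddef]; linear_combination e0
    · simp [hB1, hddef]; linear_combination a⁻¹ * e2
  refine ⟨B, hdetB, hGramB, d, hd, rfl, rfl, ?_⟩
  rw [Matrix.mul_assoc, hMB, ← Matrix.mul_assoc, Matrix.nonsing_inv_mul _ (isUnit_iff_ne_zero.2 hdetB), Matrix.one_mul]

end Core

/-! ## §2 The group form in `↥U(σ, Φ₂)(K)`: conjugation into `torusU`, to `diag(α, σ(α)⁻¹)` -/

section Group

variable {K : Type*} [Field K] (σ : K →+* K)

/-- **«HYP-CONJ₂★».**  In `U = U(σ, Φ₂)(K)` (`K` a field, `σ` involutive): a REGULAR `γ` whose characteristic polynomial has a root `α ∈ K` with `α σ(α) ≠ 1`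
is conjugate INTO THE SPLIT TORUS by an element of `U`: `∃ g ∈ U, g γ g⁻¹ = diag(d) ∈ torusU σ Φ₂`, with `d₀ = α`, `d₁ = σ(α)⁻¹` — the `n = 2` port of ★ (E2)
`exists_conj_mem_torusU_of_isRoot`. [cite: Rogawski1990, §12.5 p. 182; §3.6; §1.10 p. 9] -/
theorem exists_conj_mem_torusU_of_isRoot₂ (hσ : ∀ a, σ (σ a) = a) {J : Matrix (Fin 2) (Fin 2) K}
    (hJ : J = (StdForm.antidiagonal 2).over K) {γ : ↥(unitaryGroupOfForm σ J)} (hreg : IsRegularElt (γ : GL (Fin 2) K))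
    {α : K} (hα : ((γ : GL (Fin 2) K) : Matrix (Fin 2) (Fin 2) K).charpoly.IsRoot α) (hne : α * σ α ≠ 1) :
    ∃ g : ↥(unitaryGroupOfForm σ J), g * γ * g⁻¹ ∈ torusU σ J ∧
      ∃ d : Fin 2 → Kˣ, glDiagonal 2 K d = ((g * γ * g⁻¹ : ↥(unitaryGroupOfForm σ J)) : GL (Fin 2) K) ∧
        (d 0 : K) = α ∧ (d 1 : K) = (σ α)⁻¹ := by
  have hJ' : ∀ i j, J i j = if j = i.rev then 1 else 0 := fun i j => by rw [hJ, antidiagonal_over_apply']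
  set M : Matrix (Fin 2) (Fin 2) K := ((γ : GL (Fin 2) K) : Matrix (Fin 2) (Fin 2) K) with hMdef
  have hM : (M.map σ)ᵀ * J * M = J := γ.2
  have hdet : M.det ≠ 0 := by
    rw [hMdef, ← Matrix.GeneralLinearGroup.val_det_apply]; exact Units.ne_zero _
  obtain ⟨B, hB, hBU, d, hd, hd0, hd1, hdiag⟩ := exists_unitary_frame_diagonal_of_isRoot₂ σ hσ hJ' hM hdet hreg hα hne
  set gB : GL (Fin 2) K := Matrix.GeneralLinearGroup.mkOfDetNeZero B hB with hgBdef
  have hgBval : (gB : Matrix (Fin 2) (Fin 2) K) = B := rfl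
  have hgBU : gB ∈ unitaryGroupOfForm σ J := by rw [mem_unitaryGroupOfForm_iff, hgBval]; exact hBU
  set g : ↥(unitaryGroupOfForm σ J) := (⟨gB, hgBU⟩ : ↥(unitaryGroupOfForm σ J))⁻¹ with hgdef
  have hconj : (((g * γ * g⁻¹ : ↥(unitaryGroupOfForm σ J)) : GL (Fin 2) K) : Matrix (Fin 2) (Fin 2) K) = B⁻¹ * M * B := by
    simp only [hgdef, inv_inv, Subgroup.coe_mul, InvMemClass.coe_inv, Units.val_mul, Matrix.coe_units_inv, hgBval, hMdef]
  set d' : Fin 2 → Kˣ := fun k => Units.mk0 (d k) (hd k) with hd'def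
  have hgl : glDiagonal 2 K d' = ((g * γ * g⁻¹ : ↥(unitaryGroupOfForm σ J)) : GL (Fin 2) K) := by
    refine Units.ext ?_
    rw [coe_glDiagonal, hconj, hdiag]
    congr 1
  exact ⟨g, (mem_torusU_iff _).2 ⟨d', hgl⟩, d', hgl, hd0, hd1⟩

end Group

/-! ## §3 The field-like carrier (`x ≠ 0 → IsUnit x`), and «stable ⇒ rational» on the hyperbolic classes of `U(Φ₂)` -/

section FieldLike

variable {R : Type*} [CommRing R] [Nontrivial R] (σ : R →+* R)

/-- **(B3) OVER A FIELD-LIKE COMMUTATIVE RING** (every non-zero element a unit — the tree's local carrier `UnitaryGroup.LocalRing L v` at a NON-SPLIT place, a field only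
propositionally): same conclusion as `exists_conj_mem_torusU_of_isRoot₂`, the second slot recorded as `σ(α) · d₁ = 1`.  `IsField.toField` on the nose, as ★ (E2).
[cite: Rogawski1990, §12.5 p. 182; §3.6] -/
theorem exists_conj_mem_torusU_of_isRoot_of_isUnit₂ (hR : ∀ x : R, x ≠ 0 → IsUnit x) (hσ : ∀ a, σ (σ a) = a)
    {J : Matrix (Fin 2) (Fin 2) R} (hJ : J = (StdForm.antidiagonal 2).over R) {γ : ↥(unitaryGroupOfForm σ J)}
    (hreg : IsRegularElt (γ : GL (Fin 2) R)) {α : R} (hα : ((γ : GL (Fin 2) R) : Matrix (Fin 2) (Fin 2) R).charpoly.IsRoot α)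
    (hne : α * σ α ≠ 1) :
    ∃ g : ↥(unitaryGroupOfForm σ J), g * γ * g⁻¹ ∈ torusU σ J ∧
      ∃ d : Fin 2 → Rˣ, glDiagonal 2 R d = ((g * γ * g⁻¹ : ↥(unitaryGroupOfForm σ J)) : GL (Fin 2) R) ∧
        (d 0 : R) = α ∧ σ α * (d 1 : R) = 1 := by
  have hF : IsField R := ⟨exists_pair_ne R, mul_comm, fun {a} ha => (hR a ha).exists_right_inv⟩
  letI : Field R := hF.toField
  obtain ⟨g, hg, d, hd, hd0, hd1⟩ := exists_conj_mem_torusU_of_isRoot₂ σ hσ hJ hreg hα hne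
  have hσα : σ α ≠ 0 := by
    intro h
    rw [h, _root_.inv_zero] at hd1
    exact (d 1).ne_zero hd1
  exact ⟨g, hg, d, hd, hd0, by rw [hd1, mul_inv_cancel₀ hσα]⟩

/-- **«STABLE ⇒ RATIONAL» ON THE HYPERBOLIC CLASSES OF `U(Φ₂)`** (field-like `R`, `σ` involutive): if `γ ∈ U = U(σ, Φ₂)(R)` is REGULAR with an eigenvalue `α`,
`α σ(α) ≠ 1`, and `δ ∈ U` is conjugate to `γ` in the ambient `GL₂(R)` (= stably conjugate, ★ `IsStablyConj`), then `γ` and `δ` are conjugate IN `U`: both are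
`U`-conjugate to `diag(d)` with `d₀ = α`, `σ(α) d₁ = 1`, and such a `d` is UNIQUE.  No Galois cohomology. [cite: Rogawski1990, §3.1 p. 19; §3.6; §12.5 p. 182] -/
theorem isConj_of_isConj_coe_of_isRoot₂ (hR : ∀ x : R, x ≠ 0 → IsUnit x) (hσ : ∀ a, σ (σ a) = a)
    {J : Matrix (Fin 2) (Fin 2) R} (hJ : J = (StdForm.antidiagonal 2).over R) {γ δ : ↥(unitaryGroupOfForm σ J)}
    (hreg : IsRegularElt (γ : GL (Fin 2) R)) {α : R} (hα : ((γ : GL (Fin 2) R) : Matrix (Fin 2) (Fin 2) R).charpoly.IsRoot α)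
    (hne : α * σ α ≠ 1) (hst : IsConj (γ : GL (Fin 2) R) (δ : GL (Fin 2) R)) : IsConj γ δ := by
  -- `δ` is regular with the same characteristic polynomial
  obtain ⟨c, hc⟩ := isConj_iff.1 hst
  have hchar : ((δ : GL (Fin 2) R) : Matrix (Fin 2) (Fin 2) R).charpoly = ((γ : GL (Fin 2) R) : Matrix (Fin 2) (Fin 2) R).charpoly := by
    rw [← hc, Units.val_mul, Units.val_mul, Matrix.coe_units_inv, Matrix.charpoly_units_conj]
  have hregδ : IsRegularElt (δ : GL (Fin 2) R) := isRegularElt_of_isConj hst hreg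
  have hαδ : ((δ : GL (Fin 2) R) : Matrix (Fin 2) (Fin 2) R).charpoly.IsRoot α := by rw [hchar]; exact hα
  -- both are `U`-conjugate to `diag(α, σ(α)⁻¹)`
  obtain ⟨g₁, -, d₁, hd₁, hd₁0, hd₁1⟩ := exists_conj_mem_torusU_of_isRoot_of_isUnit₂ σ hR hσ hJ hreg hα hne
  obtain ⟨g₂, -, d₂, hd₂, hd₂0, hd₂1⟩ := exists_conj_mem_torusU_of_isRoot_of_isUnit₂ σ hR hσ hJ hregδ hαδ hne
  have hd : d₁ = d₂ := by
    funext k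
    refine Units.ext ?_
    fin_cases k
    · exact hd₁0.trans hd₂0.symm
    · -- `σ α · d₁ 1 = 1 = σ α · d₂ 1`
      calc (d₁ 1 : R) = d₁ 1 * (σ α * d₂ 1) := by rw [hd₂1, mul_one]
        _ = σ α * d₁ 1 * d₂ 1 := by ring
        _ = d₂ 1 := by rw [hd₁1, one_mul]
  have heq : g₁ * γ * g₁⁻¹ = g₂ * δ * g₂⁻¹ := by
    apply Subtype.ext
    rw [← hd₁, ← hd₂, hd]
  refine isConj_iff.2 ⟨g₂⁻¹ * g₁, ?_⟩
  calc g₂⁻¹ * g₁ * γ * (g₂⁻¹ * g₁)⁻¹ = g₂⁻¹ * (g₁ * γ * g₁⁻¹) * g₂ := by group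
    _ = g₂⁻¹ * (g₂ * δ * g₂⁻¹) * g₂ := by rw [heq]
    _ = δ := by group

end FieldLike

/-! ## §4 `H_v`-level at a non-split place: on the hyperbolic classes of `H_v = U(Φ₂)(L⁺_v) × U(Φ₁)(L⁺_v)` stable conjugacy is conjugacy -/

section CM

open NumberField IsDedekindDomain
open Summit.HodgeConjecture.HodgeConjecture.Cruxes.H413.F0P3cStCharTSTorusDefs (hyperbolicSet)

variable (L : Type) [Field L] [NumberField L] [IsCMField L] (v : HeightOneSpectrum (𝓞 ↥(maximalRealSubfield L)))
  {a b : (UnitaryGroup.cmDatum L 2 (Matrix.of fun i j : Fin 2 => if i.val + j.val + 1 = 2 then (1 : L) else 0)).Local v ×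
      (UnitaryGroup.cmDatum L 1 (Matrix.of fun i j : Fin 1 => if i.val + j.val + 1 = 1 then (1 : L) else 0)).Local v}

set_option maxHeartbeats 1600000 in  -- statement-level `whnf` on the CM carriers (`cmDatum … .Local v`, `LocalRing`)
/-- The `U(Φ₂)`-slots of stably conjugate `γ_H ∼_st γ_H′` with `γ_H.1` REGULAR and HYPERBOLIC (an eigenvalue `α ∈ E_v`, `α σ(α) ≠ 1`) are conjugate in `U(Φ₂)(L⁺_v)`
(non-split `v`: §3 on the field-like carrier ★ `isUnit_of_ne_zero_of_nonsplit`, `σ_v` involutive ★ `conjLocal_conjLocal_cm`, `Φ₂ = cmLocalForm L 2 v` ★ `cmLocalForm_eq_over`).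
[cite: Rogawski1990, §3.1 p. 19; §12.5 p. 182] -/
theorem isConj_fst_of_isLocalStablyConjH_of_isRoot (hns : ∀ w : PlacesOver L v, IsCMField.complexConj L • w.1 = w.1)
    (hst : IsLocalStablyConjH L v a b) (hreg : IsRegularElt (a.1.val : GL (Fin 2) (LocalRing L v))) {α : LocalRing L v}
    (hα : ((a.1.val : GL (Fin 2) (LocalRing L v)) : Matrix (Fin 2) (Fin 2) (LocalRing L v)).charpoly.IsRoot α)
    (hne : α * conjLocal L (IsCMField.complexConj L) v α ≠ 1) : IsConj a.1 b.1 :=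
  isConj_of_isConj_coe_of_isRoot₂ (conjLocal L (IsCMField.complexConj L) v) (F0P3cStCharTSWeylHypCM.isUnit_of_ne_zero_of_nonsplit L v hns)
    (conjLocal_conjLocal_cm L v) (cmLocalForm_eq_over L 2 v)
    (γ := (a.1 : ↥(unitaryGroupOfForm (conjLocal L (IsCMField.complexConj L) v) (cmLocalForm L 2 v))))
    (δ := (b.1 : ↥(unitaryGroupOfForm (conjLocal L (IsCMField.complexConj L) v) (cmLocalForm L 2 v)))) hreg hα hne hst.1

set_option maxHeartbeats 1600000 in  -- statement-level `whnf` on the CM carriers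
/-- **(B3) «ON THE HYPERBOLIC CLASSES OF `H_v`, STABLE CONJUGACY IS `H_v`-CONJUGACY»** (non-split `v`): if `γ_H = (h₀, u) ∼_st γ_H′` in `H_v = U(Φ₂)(L⁺_v) × U(Φ₁)(L⁺_v)`
(★ `IsLocalStablyConjH`), `h₀` is regular and `charpoly h₀` has a root `α ∈ E_v` with `α σ(α) ≠ 1`, then `γ_H` and `γ_H′` are CONJUGATE in `H_v` — the `U(Φ₂)`-slots by
`isConj_fst_of_isLocalStablyConjH_of_isRoot`, the `U(Φ₁)`-slots are EQUAL (★ `isStablyConj_iff_eq_of_fin_one`).  (B4) feeds `α` from ★-cand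
`F0P3cStCharTSStableInvariantsH.exists_isRoot_charpoly_fst_of_mem_hyperbolicSet` (`G`-regular, `ι_v(γ_H) ∈ Ω`) and `hreg` from ★ `isRegularElt_fst_of_isLocalGRegular`.
[cite: Rogawski1990, §3.1 p. 19; §3.6; §12.5 p. 182; §4.3 p. 42] -/
theorem isConj_of_isLocalStablyConjH_of_isRoot (hns : ∀ w : PlacesOver L v, IsCMField.complexConj L • w.1 = w.1)
    (hst : IsLocalStablyConjH L v a b) (hreg : IsRegularElt (a.1.val : GL (Fin 2) (LocalRing L v))) {α : LocalRing L v}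
    (hα : ((a.1.val : GL (Fin 2) (LocalRing L v)) : Matrix (Fin 2) (Fin 2) (LocalRing L v)).charpoly.IsRoot α)
    (hne : α * conjLocal L (IsCMField.complexConj L) v α ≠ 1) : IsConj a b := by
  obtain ⟨c, hc⟩ := isConj_iff.1 (isConj_fst_of_isLocalStablyConjH_of_isRoot L v hns hst hreg hα hne)
  have h2 : a.2 = b.2 := isStablyConj_iff_eq_of_fin_one.1 hst.2
  refine isConj_iff.2 ⟨(c, 1), ?_⟩
  ext
  · simpa using hc
  · simp [h2]

/-! ## §5 The (B4) head by name: on `{G-regular} ∖ V_H` (i.e. `ι_v(γ_H) ∈ Ω`) stable conjugacy is `H_v`-conjugacy (non-split `v`) -/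

set_option maxHeartbeats 1600000 in  -- statement-level `whnf` on the CM carriers
/-- **ST-STABLE-H★ (B3) HEAD, AS CONSUMED BY (B4)**: at a non-split `v`, a `G`-regular `γ_H ∈ H_v` whose image `ι_v(γ_H)` lies in the regular hyperbolic set `Ω` (★
`F0P3cStCharTSTorusDefs.hyperbolicSet`) is CONJUGATE in `H_v` to every `γ_H′` stably conjugate to it: ★ p851650 `exists_isRoot_charpoly_fst_of_mem_hyperbolicSet` reads off
`Ω` a root `α` of `charpoly γ_H.1` with `α σ(α) ≠ 1`, ★ `isRegularElt_fst_of_isLocalGRegular` the regularity of `γ_H.1`, and §4 concludes.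
[cite: Rogawski1990, §3.1 p. 19; §12.5 p. 182; §4.3 p. 42] -/
theorem isConj_of_isLocalStablyConjH_of_mem_hyperbolicSet (hns : ∀ w : PlacesOver L v, IsCMField.complexConj L • w.1 = w.1)
    (hab : IsLocalStablyConjH L v a b) (hreg : IsLocalGRegular L v a) (hΩ : endoEmbLocal L v a ∈ hyperbolicSet L v) : IsConj a b := by
  obtain ⟨α, hα, hne⟩ := F0P3cStCharTSStableInvariantsH.exists_isRoot_charpoly_fst_of_mem_hyperbolicSet L v hns hΩ
  exact isConj_of_isLocalStablyConjH_of_isRoot L v hns hab (F0P3cStCharTSStableInvariantsH.isRegularElt_fst_of_isLocalGRegular L v hreg) hα hne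

set_option maxHeartbeats 1600000 in  -- statement-level `whnf` on the CM carriers
/-- The same without the `G`-regularity hypothesis, which `ι_v(γ_H) ∈ Ω` implies (★ p851650 `isLocalGRegular_of_mem_hyperbolicSet`). [cite: Rogawski1990, §12.5 p. 182; §3.1 p. 19] -/
theorem isConj_of_isLocalStablyConjH_of_mem_hyperbolicSet' (hns : ∀ w : PlacesOver L v, IsCMField.complexConj L • w.1 = w.1)
    (hab : IsLocalStablyConjH L v a b) (hΩ : endoEmbLocal L v a ∈ hyperbolicSet L v) : IsConj a b :=
  isConj_of_isLocalStablyConjH_of_mem_hyperbolicSet L v hns hab (F0P3cStCharTSStableInvariantsH.isLocalGRegular_of_mem_hyperbolicSet L v hΩ) hΩ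

set_option maxHeartbeats 1600000 in  -- statement-level `whnf` on the CM carriers
/-- **ON THE HYPERBOLIC CLASSES, `∼_st` IS `∼`**: for `γ_H` with `ι_v(γ_H) ∈ Ω` (non-split `v`), `γ_H ∼_st γ_H′ ↔ γ_H ∼ γ_H′` in `H_v` (converse: conjugate ⇒ stably
conjugate, ★ `isStablyConjH_of_isConj`). [cite: Rogawski1990, §3.1 p. 19; §12.5 p. 182] -/
theorem isLocalStablyConjH_iff_isConj_of_mem_hyperbolicSet (hns : ∀ w : PlacesOver L v, IsCMField.complexConj L • w.1 = w.1)
    (hΩ : endoEmbLocal L v a ∈ hyperbolicSet L v) : IsLocalStablyConjH L v a b ↔ IsConj a b :=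
  ⟨fun hab => isConj_of_isLocalStablyConjH_of_mem_hyperbolicSet' L v hns hab hΩ, fun h => isStablyConjH_of_isConj h⟩

end CM

end Summit.HodgeConjecture.HodgeConjecture.Cruxes.H413.F0P3cStCharTSHypConjTwo
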